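/-
Origin: expansion seat `planner-pub-hodgecm-pv05-g5-0`, handover #4 2026-08-18T09:17:06Z (`HOME/pub-hodgecm-pv05-g5/lean/Pv05g5/FourierUniqueness.lean`, md5 aa9fc382, 113 lines);
landed by the gen-7 packager in gate run 27 as `HodgeCM/PerL34/FourierUniqueness.lean` (verbatim).
-/
/-
Copyright (c) 2026. Released under the Apache 2.0 license (see the HodgeCMPerL package LICENSE).
HodgeCM/PerL34/FourierUniqueness.lean — pub-hodgecm DAG node `FourierUniqueness` (seat pv05, gen 5).

# Fourier uniqueness on `L¹(ℝⁿ)` — a generic, Mathlib-only leaf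

"By Fourier uniqueness" is the one classical input of Folland's completeness proof for the Hermite functions
[Fo89 = G. B. Folland, *Harmonic Analysis in Phase Space*, Princeton UP 1989, Ch. 1 §7 (vii), held text
`book:folland1989-harmonic-analysis-phase-space` chunk p0047 L24–L27: "... so by Fourier uniqueness
`g(x)e^{−πx²} = 0` a.e., and hence `g = 0`"].  Mathlib (this snapshot) has Fourier inversion for functions with
integrable transform that are continuous at the point, and the Fourier pair on Schwartz space, but not the
injectivity of the Fourier transform on all of `L¹`; this file derives it, with ZERO hypotheses beyond
integrability and ZERO cited facts:

* `ae_eq_zero_of_fourier_eq_zero (hf : Integrable f) (h0 : ∀ ξ, 𝓕 f ξ = 0) : f =ᵐ[volume] 0`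
  for `f : V → ℂ` on a finite-dimensional real inner product space `V` (Borel, `volume`);
* `ae_eq_zero_of_integral_cexp_mul_eq_zero (hF : Integrable F)
    (h0 : ∀ ξ, ∫ x, cexp (↑(−2π Σ_k x_k ξ_k) * I) * F x = 0) : F =ᵐ[volume] 0`
  for `F : (σ → ℝ) → ℂ`, `σ` a finite type — the coordinate form used downstream
  (`HodgeCM.PerL34.FockHermiteComplete`), transported along the measure-preserving
  `EuclideanSpace.volume_preserving_symm_measurableEquiv_toLp`.

Proof (standard duality argument): for a compactly supported smooth test function `g`, let `φ` be the Schwartz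
function `g` (`HasCompactSupport.toSchwartzMap`) and `ψ = 𝓕⁻¹ φ` (Schwartz, `𝓕 ψ = φ`); by the self-adjointness
of the Fourier integral (`VectorFourier.integral_bilin_fourierIntegral_eq_flip`, valid for `f ∈ L¹` against a
Schwartz function) `∫ f φ = ∫ f · 𝓕ψ = ∫ 𝓕f · ψ = 0`; hence `∫ g • f = 0` for all such `g`, and
`ae_eq_zero_of_integral_contDiff_smul_eq_zero` (Mathlib) gives `f = 0` a.e.

Policy: imports `Mathlib` only; no placeholders, no new axioms; additive leaf (nothing imports it except the
seat's `FockHermiteComplete`).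
-/
import Mathlib

/-! PORT of `HodgeCM/PerL34/FourierUniqueness.lean` (HodgeCMPerL run 81) — verbatim mechanical port; provenance in the PORT header line. -/

set_option autoImplicit false

open MeasureTheory Complex SchwartzMap
open scoped Real FourierTransform RealInnerProductSpace

namespace HodgeCM.PerL34.FourierUniq

section InnerProduct

variable {V : Type*} [NormedAddCommGroup V] [InnerProductSpace ℝ V] [FiniteDimensional ℝ V]
  [MeasurableSpace V] [BorelSpace V]

/-- Self-adjointness `∫ 𝓕f · g = ∫ f · 𝓕g` for `f ∈ L¹` and `g` Schwartz. -/
theorem integral_fourier_mul_eq_of_integrable {f : V → ℂ} (hf : Integrable f) (g : 𝓢(V, ℂ)) :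
    ∫ ξ, 𝓕 f ξ * g ξ = ∫ x, f x * 𝓕 (g : V → ℂ) x := by
  have h := VectorFourier.integral_bilin_fourierIntegral_eq_flip (ContinuousLinearMap.mul ℂ ℂ)
    (L := innerₗ V) Real.continuous_fourierChar continuous_inner hf (g.integrable (μ := volume))
  change ∫ ξ, VectorFourier.fourierIntegral 𝐞 volume (innerₗ V) f ξ * g ξ =
    ∫ x, f x * VectorFourier.fourierIntegral 𝐞 volume (innerₗ V) (⇑g) x
  simpa using h

/-- **Fourier uniqueness on `L¹`**: an integrable function whose Fourier transform vanishes identically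
vanishes almost everywhere. -/
theorem ae_eq_zero_of_fourier_eq_zero {f : V → ℂ} (hf : Integrable f) (h0 : ∀ ξ, 𝓕 f ξ = 0) :
    f =ᵐ[volume] 0 := by
  refine ae_eq_zero_of_integral_contDiff_smul_eq_zero hf.locallyIntegrable fun g hg hsupp => ?_
  set G : V → ℂ := fun x => (g x : ℂ) with hGdef
  have hG1 : HasCompactSupport G := hsupp.comp_left Complex.ofReal_zero
  have hG2 : ContDiff ℝ (⊤ : ℕ∞) G := (Complex.ofRealCLM.contDiff.comp hg)
  let φ : 𝓢(V, ℂ) := hG1.toSchwartzMap hG2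
  let ψ : 𝓢(V, ℂ) := 𝓕⁻ φ
  have hψ : 𝓕 (ψ : V → ℂ) = G := by
    have h1 : ((𝓕 ψ : 𝓢(V, ℂ)) : V → ℂ) = 𝓕 (ψ : V → ℂ) := fourier_coe ψ
    rw [← h1, show 𝓕 ψ = φ from FourierTransform.fourier_fourierInv_eq φ]
    rfl
  have hcomm : (fun x => g x • f x) = fun x => f x * 𝓕 (ψ : V → ℂ) x := by
    funext x
    rw [hψ, Complex.real_smul, mul_comm]
  rw [hcomm, ← integral_fourier_mul_eq_of_integrable hf ψ]
  simp [h0]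

end InnerProduct

section Pi

variable {σ : Type*} [Fintype σ]

/-- **Fourier uniqueness on `L¹(ℝ^σ)`** in coordinates: if `F : (σ → ℝ) → ℂ` is integrable and
`∫ e^{−2πi x·ξ} F(x) dx = 0` for every `ξ`, then `F = 0` a.e. (Lebesgue measure on `σ → ℝ`). -/
theorem ae_eq_zero_of_integral_cexp_mul_eq_zero {F : (σ → ℝ) → ℂ} (hF : Integrable F)
    (h0 : ∀ ξ : σ → ℝ, ∫ x : σ → ℝ, cexp (((-2 * π * ∑ k, x k * ξ k : ℝ) : ℂ) * I) * F x = 0) :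
    F =ᵐ[volume] 0 := by
  -- move to `EuclideanSpace ℝ σ`
  have hmp := EuclideanSpace.volume_preserving_symm_measurableEquiv_toLp σ
  have hemb := (MeasurableEquiv.toLp 2 (σ → ℝ)).symm.measurableEmbedding
  have hF' : Integrable (fun v : EuclideanSpace ℝ σ => F (WithLp.ofLp v)) :=
    (hmp.integrable_comp_emb hemb).mpr hF
  have hzero : ∀ ξ : EuclideanSpace ℝ σ, 𝓕 (fun v : EuclideanSpace ℝ σ => F (WithLp.ofLp v)) ξ = 0 := by
    intro ξ
    have hinner : ∀ v : EuclideanSpace ℝ σ, ⟪v, ξ⟫ = ∑ k, WithLp.ofLp v k * WithLp.ofLp ξ k := fun v => by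
      rw [PiLp.inner_apply]
      refine Finset.sum_congr rfl fun k _ => ?_
      simp [mul_comm]
    have hcomp : ∫ v : EuclideanSpace ℝ σ,
        cexp (((-2 * π * ∑ k, WithLp.ofLp v k * WithLp.ofLp ξ k : ℝ) : ℂ) * I) * F (WithLp.ofLp v) =
        ∫ x : σ → ℝ, cexp (((-2 * π * ∑ k, x k * WithLp.ofLp ξ k : ℝ) : ℂ) * I) * F x :=
      hmp.integral_comp' (f := (MeasurableEquiv.toLp 2 (σ → ℝ)).symm)
        (fun x : σ → ℝ => cexp (((-2 * π * ∑ k, x k * WithLp.ofLp ξ k : ℝ) : ℂ) * I) * F x)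
    rw [Real.fourier_eq']
    simp_rw [smul_eq_mul, hinner]
    rw [hcomp]
    exact h0 (WithLp.ofLp ξ)
  have hae := ae_eq_zero_of_fourier_eq_zero hF' hzero
  -- transfer the a.e. statement back along the measure-preserving equivalence
  rw [← hmp.map_eq]
  exact hemb.ae_map_iff.mpr hae

end Pi

end HodgeCM.PerL34.FourierUniq
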